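/-
Copyright: cell pub-balaban-gaps (YM BLITZ Y1, track G1), seat g1-p2 GEN 8 (unit `pub-balaban-gaps-g1-p2`).  Row (D4) NODE O,
OBJECT ∕ MECHANISM level, CARRIER-GENERIC (sequel of `D4WalkBlockShiftStep`): [B9] Cor. 3.5's step for the covariant shift PLUS a
cube-local averaging correction `V_av` (the shape of (3.57)–(3.60)'s averaging part), and for the covariant Laplacian in a TRANSPORTER
background — defects `W⁺ = conjOp U U⁻ − 1`, `W⁻ = conjOp U⁻(x − e_μ) U(x − e_μ) − 1` with the bond ∕ divergence windows DERIVED from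
(3.37)-type letters on the transporters (fibre algebra of `D4WalkBlockTransportAlgebra`) — on ANY kernel with value + forward-derivative
letters over any finite carrier with shift permutations (62 ∕ 60b freed from `Site P 0`).  HONEST FRAMING: elementary; nothing of
Bałaban's `U′ = e^{iηA}` ∕ `V′(A)` constructed; (D4) NOT discharged (instance 0∕1); NOT BetaPertH, NOT continuum, NOT Clay.
-/
import Summits.QuantumFields.BalabanUV.Gaps.D4WalkBlockShiftStep
import Summits.QuantumFields.BalabanUV.Gaps.D4WalkBlockTransportAlgebra
import Summits.QuantumFields.BalabanUV.Gaps.D4WalkBlockExpWindow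

/-!
# `Gaps.D4WalkBlockShiftTransport` — Cor. 3.5's step with a cube-local averaging slot, and in a transporter background from
# (3.37)-type letters, carrier-generic (cell pub-balaban-gaps, seat g1-p2 gen 8)

HONEST DEPENDENCY (cell pub-balaban, verbatim): continuum YM on T⁴ ⇐ BetaPertH ∧ nine spine estimates (0/9 proved);
BetaPertH ⇐ (D1) ∧ (D4) ∧ CAP+tail.

* §1 the averaging slot (62 generic): `blockNorm_rowSum_le`, **`covShiftAv_dominated`** (`‖(V_W + V_av)S‖ ≤ (α′ + α_av)‖S‖ + Σ_ι α‖D_ιS‖`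
  for a CUBE-LOCAL `V_av` with full row sums `≤ α_av`), `covShiftAv_holo`, **`blockWalkExpansion_covShiftAv_of_letters`**;
* §2 the transporter background (60b generic): `rowMass_sum_le'`, `differentiableOn_defect'`,
  **`blockWalkExpansion_transport_of_letters`** — for holomorphic forward bond transporters `U⁺_μ(u,x) ∈ Matrix (Fin N) (Fin N) ℂ` with
  inverses (`U⁺U⁻ = 1`), the BOND letter (row ∕ column sums of `U⁺ − 1`, `U⁻ − 1` at most `ηα₀`) and the DERIVATIVE letter (row ∕
  column sums of `U⁺_μ(u,x) − U⁺_μ(u,x − e_μ)` at most `η²α₁`) — print's (3.37) —, `η ∈ (0, 1]`, a cube-local `V_av` (`α_av`), any kernel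
  `G` with the value ∕ forward-derivative letters `(C, ρ)`: `G(1 − (V_W + V_av)G)⁻¹` is a block walk expansion with the relative
  derivative letters `covB ρ`, margin with `α = 2α₀ + α₀²`, `α′ = |ι|(2α₁ + 4α₀²) + α_av` (60a's `rowMass_defect_le_of_letters`,
  `rowMass_defect_pair_le` BY NAME).
* §3 **`blockWalkExpansion_expTransport_of_letters`** (61b generic) — `U⁺ = e^{X}`, `U⁻ = e^{−X}` for bond fields `X_μ(u,x)` with the two
  (3.37)-SHAPED WINDOWS (row ∕ column sums of `X` at most `ηa₀`, of `X(b) − X(b − e_μ)` at most `η²a₁`; print `X = iηA`): the transporter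
  letters follow with `α₀ = a₀e^{a₀}`, `α₁ = a₁e^{a₀}` (61a's `rowSumNorm_exp_sub_one_le` ∕ `rowSumNorm_exp_sub_exp_le` BY NAME), hence §2.
WHAT IT IS NOT.  The genuine averaging `P_K(U)` and contour transporters (63–66); instances (one-scale = 60b∕61b; multi-level =
`D4WalkBlockCovariantTransportMultiLevel`); (D4) instance 0∕1; words of row (D4) UNCHANGED.

References: T. Bałaban, Comm. Math. Phys. **99** (1985) 389–434 [B9], (3.37) p. 396, (3.50)–(3.54) pp. 400–401, (3.57)–(3.65) pp. 401–403,
Cor. 3.5 p. 407; Comm. Math. Phys. **116** (1988) [II], (1.11) p. 5.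
-/

noncomputable section

namespace Summit.QuantumFields.BalabanUV.Gaps.D4WalkBlockShiftTransport

open Metric Set Finset NormedSpace
open scoped Matrix
open Literature.MathematicalPhysics.QuantumFieldTheory.Balaban1983to89
open Literature.MathematicalPhysics.QuantumFieldTheory.Balaban1983to89.B9SectDWalk (DomBy)
open Literature.MathematicalPhysics.QuantumFieldTheory.Balaban1983to89.B9Thm34Ext (toB6)
open Literature.MathematicalPhysics.QuantumFieldTheory.Balaban1983to89.B9Thm37GlueTorus (torusGeom tdist1 tdist1_nonneg)
open Literature.MathematicalPhysics.QuantumFieldTheory.Balaban1983to89.TreeLengthTorus (TPt)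
open Literature.MathematicalPhysics.QuantumFieldTheory.Balaban1983to89.B5TorusCover (UT)
open Literature.MathematicalPhysics.QuantumFieldTheory.Balaban1983to89.B11SectG (RowSum)
open Summit.QuantumFields.BalabanUV.Gaps.D4WalkBlock (blockNorm blockNorm_le_of_rowMass_le blockNorm_add_le BlockWalkExpansion)
open Summit.QuantumFields.BalabanUV.Gaps.D4WalkBlockDerivative (blockNorm_localMul_le blockWalkExpansion_perturb_of_derivLetters)
open Summit.QuantumFields.BalabanUV.Gaps.D4WalkBlockFlatLetters (blockWalkExpansion_const)
open Summit.QuantumFields.BalabanUV.Gaps.D4WalkBlockTransportAlgebra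
  (conjOp rowSumNorm colSumNorm rowMass_defect_le_of_letters rowMass_defect_pair_le)
open Summit.QuantumFields.BalabanUV.Gaps.D4WalkBlockShiftAlgebra
open Summit.QuantumFields.BalabanUV.Gaps.D4WalkBlockShiftStep (blockWalkExpansion_covShift_of_letters)
open Summit.QuantumFields.BalabanUV.Gaps.D4WalkBlockExpWindow
  (rowSumNorm_neg colSumNorm_neg rowSumNorm_exp_sub_one_le colSumNorm_exp_sub_one_le rowSumNorm_exp_sub_exp_le
  colSumNorm_exp_sub_exp_le exp_sub_one_le_eps)

variable {X : Type} {F : Type}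
variable {ν : ℕ} {Kv : Fin ν → ℕ}

/-! ## §1. The cube-local averaging slot -/

section Averaging
variable [Fintype X] [Fintype F] [DecidableEq X] [DecidableEq F] {ι : Type} [Fintype ι] {sh : ι → X ≃ X} {η : ℝ}
variable {E : Type*} [NormedAddCommGroup E] [NormedSpace ℂ E]
variable {Wp Wm : ι → E → X → Matrix F F ℂ} {Vav : E → Matrix (X × F) (X × F) ℂ}

omit [DecidableEq X] [DecidableEq F] in
/-- A block bound of a matrix from a uniform bound on its FULL row sums. -/
theorem blockNorm_rowSum_le (cub : X × F → UT Kv) (V : Matrix (X × F) (X × F) ℂ) {β : ℝ} (hβ : 0 ≤ β)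
    (hrow : ∀ p, ∑ q, ‖V p q‖ ≤ β) (Y Y' : UT Kv) : blockNorm cub cub V Y Y' ≤ β := by
  refine blockNorm_le_of_rowMass_le cub cub V Y Y' hβ fun p _ => le_trans ?_ (hrow p)
  exact Finset.sum_le_sum_of_subset_of_nonneg (Finset.filter_subset _ _) fun _ _ _ => norm_nonneg _

omit [NormedSpace ℂ E] in
/-- **THE (3.61) LETTER OF `V_W + V_av`**: the two windows for the defects (`η > 0`) plus a CUBE-LOCAL `V_av(u)` with full row sums at
most `α_av` on the ball ⟹ `‖(V_W(u) + V_av(u))S‖_{Y,Y′} ≤ (α′ + α_av)‖S‖_{Y,Y′} + Σ_ι α‖D_ιS‖_{Y,Y′}`.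
[cite: Balaban1985BackgroundPropagators, (3.57)–(3.61) pp.401–402, (3.37) p.396] -/
theorem covShiftAv_dominated [∀ i, NeZero (Kv i)] (cub : X → UT Kv) (hη : 0 < η) {R α α' αav : ℝ} (hα : 0 ≤ α)
    (hα' : 0 ≤ α') (hαav : 0 ≤ αav)
    (hWp : ∀ μ, ∀ u ∈ ball (0 : E) R, ∀ x a, ∑ b, ‖Wp μ u x a b‖ ≤ η * α)
    (hWm : ∀ μ, ∀ u ∈ ball (0 : E) R, ∀ x a, ∑ b, ‖Wm μ u x a b‖ ≤ η * α)
    (hdiv : ∀ u ∈ ball (0 : E) R, ∀ x a, ∑ b, ‖(∑ μ, (Wp μ u x + Wm μ u x)) a b‖ ≤ η ^ 2 * α')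
    (hloc : ∀ u p q, Vav u p q ≠ 0 → cub p.1 = cub q.1) (hav : ∀ u ∈ ball (0 : E) R, ∀ p, ∑ q, ‖Vav u p q‖ ≤ αav) :
    ∀ u ∈ ball (0 : E) R, ∀ (S : Matrix (X × F) (X × F) ℂ) (Y Y' : UT Kv),
      blockNorm (fun p : X × F => cub p.1) (fun p : X × F => cub p.1) ((covShift X F sh η Wp Wm u + Vav u) * S) Y Y' ≤
        (α' + αav) * blockNorm (fun p : X × F => cub p.1) (fun p : X × F => cub p.1) S Y Y' +
          ∑ j, α * blockNorm (fun p : X × F => cub p.1) (fun p : X × F => cub p.1) (covDop X F sh η j * S) Y Y' := by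
  intro u hu S Y Y'
  have h1 := covShift_dominated (sh := sh) (Wp := Wp) (Wm := Wm) cub hη hα hα' hWp hWm hdiv u hu S Y Y'
  have h2 : blockNorm (fun p : X × F => cub p.1) (fun p : X × F => cub p.1) (Vav u * S) Y Y' ≤
      αav * blockNorm (fun p : X × F => cub p.1) (fun p : X × F => cub p.1) S Y Y' :=
    blockNorm_localMul_le (fun p : X × F => cub p.1) (fun p : X × F => cub p.1) (fun p : X × F => cub p.1) (Vav u) S (hloc u)
      (fun Y'' => blockNorm_rowSum_le (fun p : X × F => cub p.1) (Vav u) hαav (hav u hu) Y'' Y'') Y Y'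
  rw [Matrix.add_mul]
  calc _ ≤ _ := blockNorm_add_le _ _ _ _ Y Y'
    _ ≤ _ := add_le_add h1 h2
    _ = _ := by ring

/-- `V_W(u) + V_av(u)` is entrywise holomorphic when the defects and `V_av` are. -/
theorem covShiftAv_holo {R : ℝ} (hWp : ∀ μ x a b, DifferentiableOn ℂ (fun u => Wp μ u x a b) (ball (0 : E) R))
    (hWm : ∀ μ x a b, DifferentiableOn ℂ (fun u => Wm μ u x a b) (ball (0 : E) R))
    (hVav : ∀ p q, DifferentiableOn ℂ (fun u => Vav u p q) (ball (0 : E) R)) :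
    ∀ p q, DifferentiableOn ℂ (fun u => (covShift X F sh η Wp Wm u + Vav u) p q) (ball (0 : E) R) := fun p q => by
  simp only [Matrix.add_apply]
  exact (covShift_holo hWp hWm p q).add (hVav p q)

variable [∀ i, NeZero (Kv i)] {dd N' : ℕ}

/-- **[B9] COR. 3.5's STEP FOR `V_W + V_av` ON ANY KERNEL WITH LETTERS** (as `D4WalkBlockShiftStep.blockWalkExpansion_covShift_of_letters`,
with the cube-local averaging correction in the `α₀` slot: margin `c_μ(c_μ·1·(1·((α′ + α_av + Σ_ι α·covB ρ ι)C))c_μ)c_μ < 1`).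
[cite: Balaban1985BackgroundPropagators, Cor. 3.5 p.407, (3.50)–(3.61) pp.400–402; Balaban1988RG2Cluster, (1.11) p.5] -/
theorem blockWalkExpansion_covShiftAv_of_letters (cub : X → UT Kv) (hη : 0 < η)
    (hsh : ∀ μ x, tdist1 Kv (cub ((sh μ).symm x)) (cub x) ≤ 1) (G : Matrix (X × F) (X × F) ℂ) {C ρ : ℝ} (hC : 0 ≤ C)
    (hρ : 0 ≤ ρ)
    (hG : ∀ Y Y', blockNorm (fun p : X × F => cub p.1) (fun p : X × F => cub p.1) G Y Y' ≤ C * Real.exp (-(ρ * tdist1 Kv Y Y')))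
    (hDG : ∀ μ Y Y', blockNorm (fun p : X × F => cub p.1) (fun p : X × F => cub p.1) (Dfw X F sh η μ * G) Y Y' ≤
      C * Real.exp (-(ρ * tdist1 Kv Y Y')))
    (c₀ : B13.Consts) (Xs : Finset (UT Kv)) (R : ℝ) (α α' αav ε μ cμ : ℝ)
    (hWph : ∀ ν x a b, DifferentiableOn ℂ (fun u => Wp ν u x a b) (ball (0 : E) R))
    (hWmh : ∀ ν x a b, DifferentiableOn ℂ (fun u => Wm ν u x a b) (ball (0 : E) R))
    (hVavh : ∀ p q, DifferentiableOn ℂ (fun u => Vav u p q) (ball (0 : E) R)) (hα : 0 ≤ α) (hα' : 0 ≤ α') (hαav : 0 ≤ αav)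
    (hWp : ∀ ν, ∀ u ∈ ball (0 : E) R, ∀ x a, ∑ b, ‖Wp ν u x a b‖ ≤ η * α)
    (hWm : ∀ ν, ∀ u ∈ ball (0 : E) R, ∀ x a, ∑ b, ‖Wm ν u x a b‖ ≤ η * α)
    (hdiv : ∀ u ∈ ball (0 : E) R, ∀ x a, ∑ b, ‖(∑ ν, (Wp ν u x + Wm ν u x)) a b‖ ≤ η ^ 2 * α')
    (hloc : ∀ u p q, Vav u p q ≠ 0 → cub p.1 = cub q.1) (hav : ∀ u ∈ ball (0 : E) R, ∀ p, ∑ q, ‖Vav u p q‖ ≤ αav)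
    (hμ : 0 ≤ μ) (hμε : 2 * μ ≤ ε) (hμκ : 2 * μ ≤ ρ - ε - μ) (hcμ : 0 ≤ cμ)
    (hrow : RowSum (toB6 (torusGeom Kv 0 0 0) 0 True) μ cμ)
    (hq : cμ * (cμ * 1 * (1 * ((α' + αav + ∑ j : ι ⊕ ι, α * covB ρ j) * C)) * cμ) * cμ < 1) :
    ∃ (W : Type) (T : W → (TPt dd N' → ℂ) → E → Matrix (X × F) (X × F) ℂ) (SX' : Set W) (A' : W → ℝ)
      (D' : W → UT Kv → UT Kv → ℝ),
      BlockWalkExpansion c₀ (fun p : X × F => cub p.1) (fun p : X × F => cub p.1)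
        (fun (_ : TPt dd N' → ℂ) u => G * (1 - (covShift X F sh η Wp Wm u + Vav u) * G)⁻¹) Xs R (ε - 2 * μ) (ρ - ε - μ - 2 * μ)
        (cμ * C * (1 * (1 - cμ * (cμ * 1 * (1 * ((α' + αav + ∑ j : ι ⊕ ι, α * covB ρ j) * C)) * cμ) * cμ)⁻¹) * cμ)
        T SX' A' D' (ρ - 2 * μ) ∧
      (∀ (j : ι ⊕ ι) ω (σ : TPt dd N' → ℂ), (∀ i, ‖σ i‖ ≤ Real.exp c₀.κ₁) → ∀ u ∈ ball (0 : E) R, ∀ Y Y',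
        blockNorm (fun p : X × F => cub p.1) (fun p : X × F => cub p.1) (covDop X F sh η j * T ω σ u) Y Y' ≤
          covB (ι := ι) ρ j * (A' ω * Real.exp (-((ρ - 2 * μ) * D' ω Y Y')))) ∧
      ∀ ω, DomBy (toB6 (torusGeom Kv 0 0 0) 0 True) (D' ω) := by
  have hW := blockWalkExpansion_const (dd := dd) (N' := N') (E := E) c₀ (fun p : X × F => cub p.1) Xs G R
    (ε := ε) (κ := ρ - ε - μ) (ρ := ρ) hC (by linarith) hG
  have hD : ∀ (j : ι ⊕ ι) (ω : Unit) (σ : TPt dd N' → ℂ), (∀ i, ‖σ i‖ ≤ Real.exp c₀.κ₁) → ∀ u ∈ ball (0 : E) R,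
      ∀ Y Y' : UT Kv,
        blockNorm (fun p : X × F => cub p.1) (fun p : X × F => cub p.1) (covDop X F sh η j * G) Y Y' ≤
          covB (ι := ι) ρ j * (C * Real.exp (-(ρ * tdist1 Kv Y Y'))) := by
    intro j _ σ _ u _ Y Y'
    cases j with
    | inl ν' =>
        show blockNorm _ _ (Dfw X F sh η ν' * G) Y Y' ≤ 1 * _
        rw [one_mul]; exact hDG ν' Y Y'
    | inr ν' =>
        show blockNorm _ _ (Sbw X F sh ν' * Dfw X F sh η ν' * G) Y Y' ≤ Real.exp ρ * _
        rw [Matrix.mul_assoc]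
        have h := blockNorm_relab_mul_le (F := F) cub ((sh ν').symm : X → X) (hsh ν') (Dfw X F sh η ν' * G) hC hρ
          (fun Y Y' => hDG ν' Y Y') Y Y'
        calc _ ≤ _ := h
          _ = _ := by ring
  exact blockWalkExpansion_perturb_of_derivLetters (Dop := covDop X F sh η) (B := covB (ι := ι) ρ)
    (V := fun u => covShift X F sh η Wp Wm u + Vav u) hW (fun _ Y Y' => le_rfl)
    (fun j => by cases j <;> simp only [covB] <;> positivity) hD (covShiftAv_holo hWph hWmh hVavh) (add_nonneg hα' hαav)
    (fun _ => hα) (covShiftAv_dominated cub hη hα hα' hαav hWp hWm hdiv hloc hav) hμ hμε hμκ (by linarith) hC hcμ hrow hq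

end Averaging

/-! ## §2. The transporter background: defects from transporters, windows from (3.37)-type letters -/

section Transport
variable [Fintype X] [DecidableEq X] {ι : Type} [Fintype ι] {sh : ι → X ≃ X} {η : ℝ} {N : ℕ}
variable {E : Type*} [NormedAddCommGroup E] [NormedSpace ℂ E]

omit [Fintype X] [DecidableEq X] [Fintype ι] [NormedAddCommGroup E] [NormedSpace ℂ E] in
/-- row mass of a finite sum of matrices. -/
theorem rowMass_sum_le' {κ m n : Type*} [Fintype n] (s : Finset κ) (A : κ → Matrix m n ℂ) (p : m) :
    ∑ q, ‖(∑ i ∈ s, A i) p q‖ ≤ ∑ i ∈ s, ∑ q, ‖A i p q‖ := by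
  calc ∑ q, ‖(∑ i ∈ s, A i) p q‖ = ∑ q, ‖∑ i ∈ s, A i p q‖ := Finset.sum_congr rfl fun q _ => by rw [Matrix.sum_apply]
    _ ≤ ∑ q, ∑ i ∈ s, ‖A i p q‖ := Finset.sum_le_sum fun q _ => norm_sum_le _ _
    _ = ∑ i ∈ s, ∑ q, ‖A i p q‖ := Finset.sum_comm

omit [Fintype X] [DecidableEq X] [Fintype ι] in
/-- entries of `conjOp (M u) (M′ u) − 1` are holomorphic when the entries of `M`, `M′` are. -/
theorem differentiableOn_defect' {s : Set E} {M M' : E → Matrix (Fin N) (Fin N) ℂ}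
    (hM : ∀ a c, DifferentiableOn ℂ (fun u => M u a c) s) (hM' : ∀ a c, DifferentiableOn ℂ (fun u => M' u a c) s)
    (p q : Fin N × Fin N) : DifferentiableOn ℂ (fun u => (conjOp (M u) (M' u) - 1) p q) s := by
  simp only [Matrix.sub_apply, conjOp, Matrix.of_apply]
  exact ((hM _ _).mul (hM' _ _)).sub (differentiableOn_const _)

variable [∀ i, NeZero (Kv i)] {dd N' : ℕ}

/-- **[B9] COR. 3.5's STEP FOR THE COVARIANT LAPLACIAN IN A TRANSPORTER BACKGROUND, FROM THE TWO (3.37)-TYPE LETTERS, ON ANY KERNEL WITH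
LETTERS OVER ANY CARRIER.**  Forward bond transporters `U⁺_μ(u, x)` with inverses `U⁻_μ(u, x)` (`U⁺U⁻ = 1`), holomorphic on a ball,
with the BOND letter (row ∕ column sums of `U^± − 1` at most `ηα₀`) and the DERIVATIVE letter (row ∕ column sums of
`U⁺_μ(u,x) − U⁺_μ(u, x − e_μ)` at most `η²α₁`), `0 < η ≤ 1`; a holomorphic cube-local `V_av` (`α_av`); a kernel `G` with value ∕ forward-
derivative letters `(C, ρ)`; cube row sum `(μ, c_μ)`, `2μ ≤ ε`, `2μ ≤ ρ − ε − μ`, and the MARGIN with `α = 2α₀ + α₀²`,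
`α′ = |ι|(2α₁ + 4α₀²) + α_av` ⟹ with the defects `W⁺_μ(x) = conjOp U⁺U⁻ − 1`, `W⁻_μ(x) = conjOp U⁻(x − e_μ)U⁺(x − e_μ) − 1`:
`G(1 − (V_W(u) + V_av(u))G)⁻¹` is a block walk expansion with the relative derivative letters `covB ρ`.
[cite: Balaban1985BackgroundPropagators, (3.37) p.396, (3.50)–(3.54) pp.400–401, (3.60)–(3.64) p.402, Cor. 3.5 p.407; Balaban1988RG2Cluster, (1.11) p.5] -/
theorem blockWalkExpansion_transport_of_letters (cub : X → UT Kv) (hη : 0 < η) (hη1 : η ≤ 1)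
    (hsh : ∀ μ x, tdist1 Kv (cub ((sh μ).symm x)) (cub x) ≤ 1) (G : Matrix (X × (Fin N × Fin N)) (X × (Fin N × Fin N)) ℂ)
    {C ρ : ℝ} (hC : 0 ≤ C) (hρ : 0 ≤ ρ)
    (hG : ∀ Y Y', blockNorm (fun p : X × (Fin N × Fin N) => cub p.1) (fun p => cub p.1) G Y Y' ≤
      C * Real.exp (-(ρ * tdist1 Kv Y Y')))
    (hDG : ∀ μ Y Y', blockNorm (fun p : X × (Fin N × Fin N) => cub p.1) (fun p => cub p.1)
      (Dfw X (Fin N × Fin N) sh η μ * G) Y Y' ≤ C * Real.exp (-(ρ * tdist1 Kv Y Y')))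
    (c₀ : B13.Consts) (Xs : Finset (UT Kv)) (R : ℝ) (Up Upi : ι → E → X → Matrix (Fin N) (Fin N) ℂ)
    (Vav : E → Matrix (X × (Fin N × Fin N)) (X × (Fin N × Fin N)) ℂ) (α₀ α₁ αav ε μ cμ : ℝ)
    (hUp : ∀ ν' x a' c, DifferentiableOn ℂ (fun u => Up ν' u x a' c) (ball (0 : E) R))
    (hUpi : ∀ ν' x a' c, DifferentiableOn ℂ (fun u => Upi ν' u x a' c) (ball (0 : E) R))
    (hVavh : ∀ p q, DifferentiableOn ℂ (fun u => Vav u p q) (ball (0 : E) R))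
    (hinv : ∀ ν' u x, Up ν' u x * Upi ν' u x = 1) (hα₀ : 0 ≤ α₀) (hα₁ : 0 ≤ α₁) (hαav : 0 ≤ αav)
    (hbond : ∀ ν', ∀ u ∈ ball (0 : E) R, ∀ x a', rowSumNorm (Up ν' u x - 1) a' ≤ η * α₀ ∧ colSumNorm (Up ν' u x - 1) a' ≤ η * α₀ ∧
      rowSumNorm (Upi ν' u x - 1) a' ≤ η * α₀ ∧ colSumNorm (Upi ν' u x - 1) a' ≤ η * α₀)
    (hder : ∀ ν', ∀ u ∈ ball (0 : E) R, ∀ x a', rowSumNorm (Up ν' u x - Up ν' u ((sh ν').symm x)) a' ≤ η ^ 2 * α₁ ∧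
      colSumNorm (Up ν' u x - Up ν' u ((sh ν').symm x)) a' ≤ η ^ 2 * α₁)
    (hloc : ∀ u p q, Vav u p q ≠ 0 → cub p.1 = cub q.1) (hav : ∀ u ∈ ball (0 : E) R, ∀ p, ∑ q, ‖Vav u p q‖ ≤ αav)
    (hμ : 0 ≤ μ) (hμε : 2 * μ ≤ ε) (hμκ : 2 * μ ≤ ρ - ε - μ) (hcμ : 0 ≤ cμ)
    (hrow : RowSum (toB6 (torusGeom Kv 0 0 0) 0 True) μ cμ)
    (hq : cμ * (cμ * 1 * (1 * (((Fintype.card ι : ℝ) * (2 * α₁ + 4 * α₀ ^ 2) + αav +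
      ∑ j : ι ⊕ ι, (2 * α₀ + α₀ ^ 2) * covB ρ j) * C)) * cμ) * cμ < 1) :
    ∃ (W : Type) (T : W → (TPt dd N' → ℂ) → E → Matrix (X × (Fin N × Fin N)) (X × (Fin N × Fin N)) ℂ)
      (SX' : Set W) (A' : W → ℝ) (D' : W → UT Kv → UT Kv → ℝ),
      BlockWalkExpansion c₀ (fun p : X × (Fin N × Fin N) => cub p.1) (fun p => cub p.1)
        (fun (_ : TPt dd N' → ℂ) u =>
          G * (1 - (covShift X (Fin N × Fin N) sh η (fun ν' u x => conjOp (Up ν' u x) (Upi ν' u x) - 1)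
              (fun ν' u x => conjOp (Upi ν' u ((sh ν').symm x)) (Up ν' u ((sh ν').symm x)) - 1) u + Vav u) * G)⁻¹) Xs R
        (ε - 2 * μ) (ρ - ε - μ - 2 * μ)
        (cμ * C * (1 * (1 - cμ * (cμ * 1 * (1 * (((Fintype.card ι : ℝ) * (2 * α₁ + 4 * α₀ ^ 2) + αav +
          ∑ j : ι ⊕ ι, (2 * α₀ + α₀ ^ 2) * covB ρ j) * C)) * cμ) * cμ)⁻¹) * cμ)
        T SX' A' D' (ρ - 2 * μ) ∧
      (∀ (j : ι ⊕ ι) ω (σ : TPt dd N' → ℂ), (∀ i, ‖σ i‖ ≤ Real.exp c₀.κ₁) → ∀ u ∈ ball (0 : E) R, ∀ Y Y',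
        blockNorm (fun p : X × (Fin N × Fin N) => cub p.1) (fun p => cub p.1)
            (covDop X (Fin N × Fin N) sh η j * T ω σ u) Y Y' ≤
          covB (ι := ι) ρ j * (A' ω * Real.exp (-((ρ - 2 * μ) * D' ω Y Y')))) ∧
      ∀ ω, DomBy (toB6 (torusGeom Kv 0 0 0) 0 True) (D' ω) := by
  have hinv' : ∀ ν' u x, Upi ν' u x * Up ν' u x = 1 := fun ν' u x => mul_eq_one_comm.1 (hinv ν' u x)
  refine blockWalkExpansion_covShiftAv_of_letters cub hη hsh G hC hρ hG hDG c₀ Xs R (2 * α₀ + α₀ ^ 2)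
    ((Fintype.card ι : ℝ) * (2 * α₁ + 4 * α₀ ^ 2)) αav ε μ cμ
    (fun ν' x p q => differentiableOn_defect' (fun a c => hUp ν' x a c) (fun a c => hUpi ν' x a c) p q)
    (fun ν' x p q => differentiableOn_defect' (fun a c => hUpi ν' _ a c) (fun a c => hUp ν' _ a c) p q) hVavh
    (by positivity) (by positivity) hαav (fun ν' u hu x p => ?_) (fun ν' u hu x p => ?_) (fun u hu x p => ?_) hloc hav
    hμ hμε hμκ hcμ hrow hq
  · obtain ⟨a', b⟩ := p
    have hδ : 0 ≤ η * α₀ := by positivity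
    calc ∑ q, ‖(conjOp (Up ν' u x) (Upi ν' u x) - 1) (a', b) q‖
        ≤ η * α₀ * (1 + η * α₀) + η * α₀ :=
          rowMass_defect_le_of_letters _ _ hδ (fun a => (hbond ν' u hu x a).1) (fun b => (hbond ν' u hu x b).2.2.2) a' b
      _ ≤ η * (2 * α₀ + α₀ ^ 2) := by nlinarith [mul_nonneg hη.le hα₀, mul_le_of_le_one_left (mul_nonneg hη.le hα₀) hη1]
  · obtain ⟨a', b⟩ := p
    have hδ : 0 ≤ η * α₀ := by positivity
    calc ∑ q, ‖(conjOp (Upi ν' u ((sh ν').symm x)) (Up ν' u ((sh ν').symm x)) - 1) (a', b) q‖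
        ≤ η * α₀ * (1 + η * α₀) + η * α₀ :=
          rowMass_defect_le_of_letters _ _ hδ (fun a => (hbond ν' u hu _ a).2.2.1) (fun b => (hbond ν' u hu _ b).2.1) a' b
      _ ≤ η * (2 * α₀ + α₀ ^ 2) := by nlinarith [mul_nonneg hη.le hα₀, mul_le_of_le_one_left (mul_nonneg hη.le hα₀) hη1]
  · obtain ⟨a', b⟩ := p
    have hδ : 0 ≤ η * α₀ := by positivity
    have hpair : ∀ ν', ∑ q, ‖((conjOp (Up ν' u x) (Upi ν' u x) - 1) +
        (conjOp (Upi ν' u ((sh ν').symm x)) (Up ν' u ((sh ν').symm x)) - 1)) (a', b) q‖ ≤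
        2 * (η ^ 2 * α₁) + 4 * (η * α₀) ^ 2 := fun ν' =>
      rowMass_defect_pair_le _ _ _ _ (hinv ν' u x) (hinv' ν' u _) hδ (fun a => (hbond ν' u hu x a).1)
        (fun b => (hbond ν' u hu x b).2.1) (fun b => (hbond ν' u hu x b).2.2.2) (fun a => (hbond ν' u hu _ a).1)
        (fun b => (hbond ν' u hu _ b).2.1) (fun a => (hbond ν' u hu _ a).2.2.1) (fun a => (hder ν' u hu x a).1)
        (fun b => (hder ν' u hu x b).2) a' b
    calc ∑ q, ‖(∑ ν', ((conjOp (Up ν' u x) (Upi ν' u x) - 1) +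
          (conjOp (Upi ν' u ((sh ν').symm x)) (Up ν' u ((sh ν').symm x)) - 1))) (a', b) q‖
        ≤ ∑ ν', ∑ q, ‖((conjOp (Up ν' u x) (Upi ν' u x) - 1) +
          (conjOp (Upi ν' u ((sh ν').symm x)) (Up ν' u ((sh ν').symm x)) - 1)) (a', b) q‖ := rowMass_sum_le' _ _ _
      _ ≤ ∑ _ν' : ι, (2 * (η ^ 2 * α₁) + 4 * (η * α₀) ^ 2) := Finset.sum_le_sum fun ν' _ => hpair ν'
      _ = η ^ 2 * ((Fintype.card ι : ℝ) * (2 * α₁ + 4 * α₀ ^ 2)) := by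
          rw [Finset.sum_const, Finset.card_univ, nsmul_eq_mul]; ring

end Transport

/-! ## §3. The exponentiated small background: `U = e^{X}` with (3.37)-shaped windows on `X` -/

section Exp
variable [Fintype X] [DecidableEq X] {ι : Type} [Fintype ι] {sh : ι → X ≃ X} {η : ℝ} {N : ℕ}
variable {E : Type*} [NormedAddCommGroup E] [NormedSpace ℂ E]
variable [∀ i, NeZero (Kv i)] {dd N' : ℕ}

/-- **[B9] COR. 3.5's STEP IN AN EXPONENTIATED SMALL BACKGROUND, CARRIER-GENERIC** ((3.37)-shaped windows on `X` ⇒ transporter letters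
with `α₀ = a₀e^{a₀}`, `α₁ = a₁e^{a₀}` ⇒ §2). [cite: Balaban1985BackgroundPropagators, (3.37) p.396, (3.50)–(3.54) pp.400–401, Cor. 3.5 p.407; Balaban1988RG2Cluster, (1.11) p.5] -/
theorem blockWalkExpansion_expTransport_of_letters (cub : X → UT Kv) (hη : 0 < η) (hη1 : η ≤ 1)
    (hsh : ∀ μ x, tdist1 Kv (cub ((sh μ).symm x)) (cub x) ≤ 1) (G : Matrix (X × (Fin N × Fin N)) (X × (Fin N × Fin N)) ℂ)
    {C ρ : ℝ} (hC : 0 ≤ C) (hρ : 0 ≤ ρ)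
    (hG : ∀ Y Y', blockNorm (fun p : X × (Fin N × Fin N) => cub p.1) (fun p => cub p.1) G Y Y' ≤
      C * Real.exp (-(ρ * tdist1 Kv Y Y')))
    (hDG : ∀ μ Y Y', blockNorm (fun p : X × (Fin N × Fin N) => cub p.1) (fun p => cub p.1)
      (Dfw X (Fin N × Fin N) sh η μ * G) Y Y' ≤ C * Real.exp (-(ρ * tdist1 Kv Y Y')))
    (c₀ : B13.Consts) (Xs : Finset (UT Kv)) (R : ℝ) (Xf : ι → E → X → Matrix (Fin N) (Fin N) ℂ)
    (Vav : E → Matrix (X × (Fin N × Fin N)) (X × (Fin N × Fin N)) ℂ) (a₀ a₁ αav ε μ cμ : ℝ)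
    (hUp : ∀ ν' x a' c, DifferentiableOn ℂ (fun u => exp (Xf ν' u x) a' c) (ball (0 : E) R))
    (hUpi : ∀ ν' x a' c, DifferentiableOn ℂ (fun u => exp (-Xf ν' u x) a' c) (ball (0 : E) R))
    (hVavh : ∀ p q, DifferentiableOn ℂ (fun u => Vav u p q) (ball (0 : E) R)) (ha₀ : 0 ≤ a₀) (ha₁ : 0 ≤ a₁) (hαav : 0 ≤ αav)
    (hw0 : ∀ ν', ∀ u ∈ ball (0 : E) R, ∀ x a', rowSumNorm (Xf ν' u x) a' ≤ η * a₀ ∧ colSumNorm (Xf ν' u x) a' ≤ η * a₀)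
    (hw1 : ∀ ν', ∀ u ∈ ball (0 : E) R, ∀ x a', rowSumNorm (Xf ν' u x - Xf ν' u ((sh ν').symm x)) a' ≤ η ^ 2 * a₁ ∧
      colSumNorm (Xf ν' u x - Xf ν' u ((sh ν').symm x)) a' ≤ η ^ 2 * a₁)
    (hloc : ∀ u p q, Vav u p q ≠ 0 → cub p.1 = cub q.1) (hav : ∀ u ∈ ball (0 : E) R, ∀ p, ∑ q, ‖Vav u p q‖ ≤ αav)
    (hμ : 0 ≤ μ) (hμε : 2 * μ ≤ ε) (hμκ : 2 * μ ≤ ρ - ε - μ) (hcμ : 0 ≤ cμ)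
    (hrow : RowSum (toB6 (torusGeom Kv 0 0 0) 0 True) μ cμ)
    (hq : cμ * (cμ * 1 * (1 * (((Fintype.card ι : ℝ) * (2 * (a₁ * Real.exp a₀) + 4 * (a₀ * Real.exp a₀) ^ 2) + αav +
      ∑ j : ι ⊕ ι, (2 * (a₀ * Real.exp a₀) + (a₀ * Real.exp a₀) ^ 2) * covB ρ j) * C)) * cμ) * cμ < 1) :
    ∃ (W : Type) (T : W → (TPt dd N' → ℂ) → E → Matrix (X × (Fin N × Fin N)) (X × (Fin N × Fin N)) ℂ)
      (SX' : Set W) (A' : W → ℝ) (D' : W → UT Kv → UT Kv → ℝ),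
      BlockWalkExpansion c₀ (fun p : X × (Fin N × Fin N) => cub p.1) (fun p => cub p.1)
        (fun (_ : TPt dd N' → ℂ) u =>
          G * (1 - (covShift X (Fin N × Fin N) sh η (fun ν' u x => conjOp (exp (Xf ν' u x)) (exp (-Xf ν' u x)) - 1)
              (fun ν' u x => conjOp (exp (-Xf ν' u ((sh ν').symm x))) (exp (Xf ν' u ((sh ν').symm x))) - 1) u + Vav u) * G)⁻¹)
        Xs R (ε - 2 * μ) (ρ - ε - μ - 2 * μ)
        (cμ * C * (1 * (1 - cμ * (cμ * 1 * (1 * (((Fintype.card ι : ℝ) * (2 * (a₁ * Real.exp a₀) + 4 * (a₀ * Real.exp a₀) ^ 2) +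
          αav + ∑ j : ι ⊕ ι, (2 * (a₀ * Real.exp a₀) + (a₀ * Real.exp a₀) ^ 2) * covB ρ j) * C)) * cμ) * cμ)⁻¹) * cμ)
        T SX' A' D' (ρ - 2 * μ) ∧
      (∀ (j : ι ⊕ ι) ω (σ : TPt dd N' → ℂ), (∀ i, ‖σ i‖ ≤ Real.exp c₀.κ₁) → ∀ u ∈ ball (0 : E) R, ∀ Y Y',
        blockNorm (fun p : X × (Fin N × Fin N) => cub p.1) (fun p => cub p.1)
            (covDop X (Fin N × Fin N) sh η j * T ω σ u) Y Y' ≤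
          covB (ι := ι) ρ j * (A' ω * Real.exp (-((ρ - 2 * μ) * D' ω Y Y')))) ∧
      ∀ ω, DomBy (toB6 (torusGeom Kv 0 0 0) 0 True) (D' ω) := by
  have hs : 0 ≤ η * a₀ := by positivity
  have hb : Real.exp (η * a₀) - 1 ≤ η * (a₀ * Real.exp a₀) := exp_sub_one_le_eps hη.le hη1 ha₀
  have hdl : η ^ 2 * a₁ * Real.exp (η * a₀) ≤ η ^ 2 * (a₁ * Real.exp a₀) := by
    rw [mul_assoc]
    exact mul_le_mul_of_nonneg_left (mul_le_mul_of_nonneg_left (Real.exp_le_exp.2 (by nlinarith)) ha₁) (by positivity)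
  refine blockWalkExpansion_transport_of_letters cub hη hη1 hsh G hC hρ hG hDG c₀ Xs R (fun ν' u x => exp (Xf ν' u x))
    (fun ν' u x => exp (-Xf ν' u x)) Vav (a₀ * Real.exp a₀) (a₁ * Real.exp a₀) αav ε μ cμ hUp hUpi hVavh (fun ν' u x => by
      rw [Matrix.exp_neg]; exact Matrix.mul_nonsing_inv _ ((Matrix.isUnit_iff_isUnit_det _).1 (Matrix.isUnit_exp _)))
    (by positivity) (by positivity) hαav (fun ν' u hu x a' => ?_) (fun ν' u hu x a' => ?_) hloc hav hμ hμε hμκ hcμ hrow hq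
  · exact ⟨(rowSumNorm_exp_sub_one_le _ hs (fun b => (hw0 ν' u hu x b).1) a').trans hb,
      (colSumNorm_exp_sub_one_le _ hs (fun b => (hw0 ν' u hu x b).2) a').trans hb,
      (rowSumNorm_exp_sub_one_le _ hs (fun b => (rowSumNorm_neg (Xf ν' u x) b).symm ▸ (hw0 ν' u hu x b).1) a').trans hb,
      (colSumNorm_exp_sub_one_le _ hs (fun b => (colSumNorm_neg (Xf ν' u x) b).symm ▸ (hw0 ν' u hu x b).2) a').trans hb⟩
  · exact ⟨(rowSumNorm_exp_sub_exp_le _ _ hs (by positivity) (fun b => (hw0 ν' u hu x b).1) (fun b => (hw0 ν' u hu _ b).1)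
        (fun b => (hw1 ν' u hu x b).1) a').trans hdl,
      (colSumNorm_exp_sub_exp_le _ _ hs (by positivity) (fun b => (hw0 ν' u hu x b).2) (fun b => (hw0 ν' u hu _ b).2)
        (fun b => (hw1 ν' u hu x b).2) a').trans hdl⟩

end Exp

end Summit.QuantumFields.BalabanUV.Gaps.D4WalkBlockShiftTransport

end
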